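import Summits.ResolutionOfSingularities.ResolutionOfSingularities.Theorems.FrobeniusLadderFInjectiveMacaulayficationVeroneseRetract
import Summits.ResolutionOfSingularities.ResolutionOfSingularities.Theorems.FrobeniusLadderFInjectiveMacaulayficationGradedChartIso
import Mathlib.RingTheory.Localization.Away.Basic
import HarnessLib

/-!
# The Veronese subalgebra is a Laurent extension of the degree-zero part (crux `FInjectiveMacaulayfication`, §16 H-G2d)

Support file for crux stmt-ResolutionOfSingularities-15315 (`FrobeniusLadder.FInjectiveMacaulayfication`), §16 THE
GRADED ENGINE (CRUX-PLAN w45a v3, line `graded-engine`, registered stub G4 `stub_gradedChartClause`; lead seat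
res-L1-w45a-lead-1; design memo GRADED-ENGINE.md v2, step (v)). [OURS · L1 W4.5a]

Setting as in `WeightCoaction`: `L = k[X]/(f)[1/u]`, `u = ā₀` of weight `N > 0`, coaction `λ`; `T₀ ⊆ L[s]` the degree-`0`
part and `A' ⊆ L[s]` the `N`-th Veronese subalgebra (coefficient `i` of class `i mod N`). Identify `T₀` with the chart `C = R[I R/u]` by
`ι : C ≃ T₀` (`GradedChartIso`); substituting `Y ↦ u/1` gives a ring map `e : C[Y] → A'`, `c ↦ ι c`, and
`A' = T₀[u/1, (u/1)⁻¹]` is the LOCALISATION of `C[Y]` at `Y` along `e`: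
`u/1` is a unit of `A'`; every element of `A'` is a `T₀`-combination of powers `(u/1)^t`, `t ∈ ℤ` (split each
coefficient into weight components and shift by powers of the degree-`N` unit `u/1`); and `e` is injective because
`u/1` is transcendental over `T₀` (a relation `∑ c_t (u/1)^t = 0` with `c_t` of degree `i` has its terms in the
distinct degrees `i + tN`).
* `exists_laurentLocalization` — `e`, with `e(C c) = ι c`, `e(Y) = u/1`, and `IsLocalization.Away Y A'` along `e`.
(The base of the polynomial ring is the chart `C` itself rather than the subalgebra `T₀`, so that the Laurent descent
`LaurentDescent.laurentDescent` applies to `C` directly.)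
No definitions, no named facts. [folklore]
-/

set_option linter.dupNamespace false

noncomputable section

open LaurentPolynomial

namespace Summit.ResolutionOfSingularities.ResolutionOfSingularities.Theorems.FInjectiveMacaulayfication.VeroneseLocalization

open Summit.ResolutionOfSingularities.ResolutionOfSingularities.Theorems.FInjectiveMacaulayfication.WeightCoaction
open Summit.ResolutionOfSingularities.ResolutionOfSingularities.Theorems.FInjectiveMacaulayfication.VeroneseRetract
open Summit.ResolutionOfSingularities.ResolutionOfSingularities.Theorems.FInjectiveMacaulayfication.VeroneseSubalgebra
open Summit.ResolutionOfSingularities.ResolutionOfSingularities.Theorems.FInjectiveMacaulayfication.GradedChartIso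
open Literature.AlgebraicGeometry.Resolution

variable {k : Type} [Field k] {n : ℕ} (w : Fin n → ℕ) (f : MvPolynomial (Fin n) k)
variable (u : MvPolynomial (Fin n) k ⧸ Ideal.span {f}) {N : ℕ} {a₀ : MvPolynomial (Fin n) k}
  (ha₀ : MvPolynomial.IsWeightedHomogeneous w a₀ N) (hu : Ideal.Quotient.mk (Ideal.span {f}) a₀ = u)
variable (lam : Localization.Away u →+* (Localization.Away u)[T;T⁻¹])
variable (hlam : ∀ a : MvPolynomial (Fin n) k,
        lam (algebraMap (MvPolynomial (Fin n) k ⧸ Ideal.span {f}) _ (Ideal.Quotient.mk (Ideal.span {f}) a)) =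
          MvPolynomial.aeval (fun j : Fin n => C (algebraMap (MvPolynomial (Fin n) k ⧸ Ideal.span {f})
            (Localization.Away u) (Ideal.Quotient.mk (Ideal.span {f}) (MvPolynomial.X j))) * T (w j : ℤ)) a)
variable (T₀ : Subalgebra k (Polynomial (Localization.Away u)))
  (hT₀ : ∀ P : Polynomial (Localization.Away u), P ∈ T₀ ↔ ∀ i : ℕ, lam (P.coeff i) = C (P.coeff i) * T (i : ℤ))
  (A' : Subalgebra k (Polynomial (Localization.Away u)))
  (hA' : ∀ P : Polynomial (Localization.Away u),
      P ∈ A' ↔ ∀ (i : ℕ) (m : ℤ), (m : ZMod N) ≠ (i : ZMod N) → (lam (P.coeff i)).coeff m = 0)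
  (I : Ideal (MvPolynomial (Fin n) k ⧸ Ideal.span {f})) (ι : blowupAlgebra I u ≃ₐ[k] T₀)

section
include hT₀

/-- A homogeneous `h` of degree `i ≥ 0` gives the element `h·sⁱ` of `T₀`. [folklore] -/
theorem C_mul_X_pow_mem_degreeZero {h : Localization.Away u} {i : ℕ} (hh : lam h = C h * T (i : ℤ)) :
    Polynomial.C h * Polynomial.X ^ i ∈ T₀ := by
  rw [hT₀]
  intro i'
  rw [Polynomial.coeff_C_mul_X_pow]
  split_ifs with hi
  · rw [hi]; exact hh
  · rw [map_zero, map_zero, zero_mul]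

end

/-! ## `Good` elements: polynomials in `u/1` over `T₀` after clearing a power of `u/1` -/

/-- Closure of "`P·(u/1)^j ∈ e₀(T₀[Y])` for some `j`" under addition. [folklore] -/
theorem good_add (e₀ : Polynomial (blowupAlgebra I u) →+* Polynomial (Localization.Away u)) (U : Polynomial (Localization.Away u))
    (hX : e₀ Polynomial.X = U) {P P' : Polynomial (Localization.Away u)}
    (hP : ∃ (Q : Polynomial (blowupAlgebra I u)) (j : ℕ), P * U ^ j = e₀ Q)
    (hP' : ∃ (Q : Polynomial (blowupAlgebra I u)) (j : ℕ), P' * U ^ j = e₀ Q) :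
    ∃ (Q : Polynomial (blowupAlgebra I u)) (j : ℕ), (P + P') * U ^ j = e₀ Q := by
  obtain ⟨Q, j, hQ⟩ := hP
  obtain ⟨Q', j', hQ'⟩ := hP'
  refine ⟨Q * Polynomial.X ^ j' + Q' * Polynomial.X ^ j, j + j', ?_⟩
  rw [map_add, map_mul, map_mul, map_pow, map_pow, hX, ← hQ, ← hQ', add_mul, pow_add, mul_assoc, mul_assoc,
    mul_comm (U ^ j') (U ^ j)]

/-- Closure under finite sums. [folklore] -/
theorem good_sum (e₀ : Polynomial (blowupAlgebra I u) →+* Polynomial (Localization.Away u)) (U : Polynomial (Localization.Away u))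
    (hX : e₀ Polynomial.X = U) {κ : Type} (S : Finset κ) (g : κ → Polynomial (Localization.Away u))
    (hg : ∀ i ∈ S, ∃ (Q : Polynomial (blowupAlgebra I u)) (j : ℕ), g i * U ^ j = e₀ Q) :
    ∃ (Q : Polynomial (blowupAlgebra I u)) (j : ℕ), (∑ i ∈ S, g i) * U ^ j = e₀ Q := by
  classical
  induction S using Finset.induction_on with
  | empty => exact ⟨0, 0, by simp⟩
  | insert a S ha ih =>
    rw [Finset.sum_insert ha]
    exact good_add f u I e₀ U hX (hg a (Finset.mem_insert_self a S)) (ih fun i hi => hg i (Finset.mem_insert_of_mem hi))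

section
include ha₀ hu hlam hT₀

/-- A homogeneous monomial `h sⁱ` with `deg h ≡ i (mod N)` becomes an element of `e₀(T₀[Y])` after multiplying by a
power of `u/1` (shift `h` by the appropriate power of the degree-`N` unit `u/1`). [folklore] -/
theorem good_hom (e₀ : Polynomial (blowupAlgebra I u) →+* Polynomial (Localization.Away u))
    (hC : ∀ c : blowupAlgebra I u, e₀ (Polynomial.C c) = ((ι c : T₀) : Polynomial (Localization.Away u)))
    (hX : e₀ Polynomial.X = Polynomial.C (algebraMap _ (Localization.Away u) u))
    (h : Localization.Away u) (m : ℤ) (i : ℕ) (hh : lam h = C h * T m) (hmi : (m : ZMod N) = (i : ZMod N)) :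
    ∃ (Q : Polynomial (blowupAlgebra I u)) (j : ℕ), Polynomial.C h * Polynomial.X ^ i *
      Polynomial.C (algebraMap _ (Localization.Away u) u) ^ j = e₀ Q := by
  have hU : lam (algebraMap _ (Localization.Away u) u) = C (algebraMap _ (Localization.Away u) u) * T (N : ℤ) :=
    coaction_algebraMap_u w f u ha₀ hu lam hlam
  have hUinv := coaction_invSelf w f u ha₀ hu lam hlam
  have hdvd : (N : ℤ) ∣ (i : ℤ) - m := by
    rw [← ZMod.intCast_eq_intCast_iff_dvd_sub, hmi, Int.cast_natCast]
  obtain ⟨t, ht⟩ := hdvd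
  obtain ⟨t', rfl | rfl⟩ := Int.eq_nat_or_neg t
  · -- `m = i - N t'`: multiply by `(u/1)^{t'}`
    have hpow : lam (algebraMap _ (Localization.Away u) u ^ t') = C (algebraMap _ (Localization.Away u) u ^ t') * T ((t' : ℤ) * N) := by
      rw [map_pow, hU, mul_pow, ← map_pow, T_pow]
    have hh' : lam (h * algebraMap _ (Localization.Away u) u ^ t') = C (h * algebraMap _ (Localization.Away u) u ^ t') *
        T (i : ℤ) := by
      rw [isHomogeneous_mul f u lam hh hpow]
      congr 2
      linarith
    refine ⟨Polynomial.C (ι.symm ⟨_, C_mul_X_pow_mem_degreeZero f u lam T₀ hT₀ hh'⟩), t', ?_⟩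
    rw [hC, AlgEquiv.apply_symm_apply, ← map_pow, mul_right_comm, ← map_mul]
  · -- `m = i + N t'`: divide by `(u/1)^{t'}`
    have hpow : lam (IsLocalization.Away.invSelf u ^ t') =
        C (IsLocalization.Away.invSelf (S := Localization.Away u) u ^ t') * T ((t' : ℤ) * (-(N : ℤ))) := by
      rw [map_pow, hUinv, mul_pow, ← map_pow, T_pow]
    have hh' : lam (h * IsLocalization.Away.invSelf u ^ t') = C (h * IsLocalization.Away.invSelf (S := Localization.Away u) u ^ t') *
        T (i : ℤ) := by
      rw [isHomogeneous_mul f u lam hh hpow]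
      congr 2
      linarith
    refine ⟨Polynomial.C (ι.symm ⟨_, C_mul_X_pow_mem_degreeZero f u lam T₀ hT₀ hh'⟩) * Polynomial.X ^ t', 0, ?_⟩
    rw [pow_zero, mul_one, map_mul, map_pow, hC, AlgEquiv.apply_symm_apply, hX, ← map_pow, mul_right_comm, ← map_mul,
      mul_assoc, ← mul_pow, mul_comm (IsLocalization.Away.invSelf u), IsLocalization.Away.mul_invSelf, one_pow, mul_one]

end

section
include hT₀

/-- **`u/1` is transcendental over `T₀`**: the substitution `Y ↦ u/1` on `T₀[Y]` is injective (a relation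
`∑ c_t (u/1)^t = 0` with `deg c_t = i` has its terms in the distinct degrees `i + tN`, `N > 0`). [folklore] -/
theorem eval_u_injective (hN : 0 < N) (e₀ : Polynomial (blowupAlgebra I u) →+* Polynomial (Localization.Away u))
    (he₀ : e₀ = Polynomial.eval₂RingHom ((T₀.val.comp (ι : blowupAlgebra I u →ₐ[k] T₀)).toRingHom)
      (Polynomial.C (algebraMap _ (Localization.Away u) u)))
    (hU : lam (algebraMap _ (Localization.Away u) u) = C (algebraMap _ (Localization.Away u) u) * T (N : ℤ))
    (D : Polynomial (blowupAlgebra I u)) (h0 : e₀ D = 0) : D = 0 := by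
  classical
  have hUpow : ∀ t : ℕ, lam (algebraMap _ (Localization.Away u) u ^ t) =
      C (algebraMap _ (Localization.Away u) u ^ t) * T ((t : ℤ) * N) := fun t => by
    rw [map_pow, hU, mul_pow, ← map_pow, T_pow]
  have hUunit : ∀ t : ℕ, IsUnit (algebraMap _ (Localization.Away u) u ^ t) := fun t =>
    (IsLocalization.Away.algebraMap_isUnit u).pow t
  -- coefficients: `∑_t c_{t,i} (u/1)^t = 0` with `deg c_{t,i} = i`
  have hexp : ∀ i : ℕ, ∑ t ∈ D.support, ((ι (D.coeff t) : T₀) : Polynomial (Localization.Away u)).coeff i *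
      algebraMap _ (Localization.Away u) u ^ t = 0 := by
    intro i
    have h1 : (e₀ D).coeff i = 0 := by rw [h0, Polynomial.coeff_zero]
    rw [he₀, Polynomial.coe_eval₂RingHom, Polynomial.eval₂_eq_sum, Polynomial.sum_def, Polynomial.finsetSum_coeff] at h1
    rw [← h1]
    refine Finset.sum_congr rfl fun t _ => ?_
    rw [← Polynomial.C_pow, Polynomial.coeff_mul_C]
    rfl
  refine Polynomial.ext fun t₀ => ?_
  rw [Polynomial.coeff_zero, ← map_eq_zero_iff ι ι.injective]
  refine Subtype.ext (Polynomial.ext fun i => ?_)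
  rw [ZeroMemClass.coe_zero, Polynomial.coeff_zero]
  by_cases ht₀ : t₀ ∈ D.support
  · have hc : ∀ t : ℕ, lam (((ι (D.coeff t) : T₀) : Polynomial (Localization.Away u)).coeff i *
        algebraMap _ (Localization.Away u) u ^ t) = C (((ι (D.coeff t) : T₀) : Polynomial (Localization.Away u)).coeff i *
        algebraMap _ (Localization.Away u) u ^ t) * T ((i : ℤ) + t * N) := fun t =>
      isHomogeneous_mul f u lam ((hT₀ _).mp (ι (D.coeff t)).2 i) (hUpow t)
    have h2 := congrArg (fun x => (lam x).coeff ((i : ℤ) + t₀ * N)) (hexp i)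
    simp only [map_zero, AddMonoidAlgebra.coeff_zero, Finsupp.zero_apply] at h2
    rw [coeff_map_sum f u lam, Finset.sum_eq_single t₀, coeff_of_isHomogeneous f u lam (hc t₀), if_pos rfl] at h2
    · exact (IsUnit.mul_left_eq_zero (hUunit t₀)).mp h2
    · intro t _ ht
      rw [coeff_of_isHomogeneous f u lam (hc t), if_neg]
      intro h
      apply ht
      have hN0 : (N : ℤ) ≠ 0 := by exact_mod_cast hN.ne'
      have := mul_right_cancel₀ hN0 (add_left_cancel h)
      exact_mod_cast this.symm
    · intro h; exact absurd ht₀ h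
  · rw [Polynomial.notMem_support_iff.mp ht₀, map_zero, ZeroMemClass.coe_zero, Polynomial.coeff_zero]

end

section
include ha₀ hu hlam hT₀ hA'

set_option maxHeartbeats 400000 in
/-- **`A'` is the localisation of `T₀[Y]` at `Y` along `Y ↦ u/1`.** There is a ring map `e : T₀[Y] → A'` with
`e (C t) = t` and `e Y = u/1` (as polynomials in `L[s]`) such that `A'` is `IsLocalization.Away Y` over `T₀[Y]` via
`e`: `u/1` is a unit of `A'` (inverse `(1/u)/1 ∈ A'`), every element of `A'` becomes a polynomial in `u/1` over `T₀`
after multiplication by a power of `u/1` (weight decomposition of its coefficients, `good_hom`), and `e` is injective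
(`eval_u_injective`). [folklore] -/
theorem exists_laurentLocalization (hN : 0 < N) :
    ∃ e : Polynomial (blowupAlgebra I u) →+* A',
      (∀ c : blowupAlgebra I u, ((e (Polynomial.C c) : A') : Polynomial (Localization.Away u)) = (ι c : T₀)) ∧
      ((e Polynomial.X : A') : Polynomial (Localization.Away u)) =
        Polynomial.C (algebraMap _ (Localization.Away u) u) ∧
      @IsLocalization.Away (Polynomial (blowupAlgebra I u)) _ Polynomial.X A' _ e.toAlgebra := by
  classical
  haveI : NeZero N := NeZero.of_pos hN
  have hU : lam (algebraMap _ (Localization.Away u) u) = C (algebraMap _ (Localization.Away u) u) * T (N : ℤ) :=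
    coaction_algebraMap_u w f u ha₀ hu lam hlam
  have hUinv := coaction_invSelf w f u ha₀ hu lam hlam
  -- memberships in `A'`
  have hCu : Polynomial.C (algebraMap _ (Localization.Away u) u) ∈ A' :=
    C_mem_veronese_of_isHomogeneous f u lam N A' hA' hU (by rw [Int.cast_natCast, ZMod.natCast_self])
  have hCinv : Polynomial.C (IsLocalization.Away.invSelf (S := Localization.Away u) u) ∈ A' :=
    C_mem_veronese_of_isHomogeneous f u lam N A' hA' hUinv (by push_cast; rw [ZMod.natCast_self, neg_zero])
  have hT₀A' : T₀ ≤ A' := fun P hP => mem_veronese_of_degreeZero f u lam N A' hA' ((hT₀ P).mp hP)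
  -- the substitution map `e₀ : T₀[Y] → L[s]`, `Y ↦ u/1`
  obtain ⟨e₀, he₀⟩ : ∃ e₀ : Polynomial (blowupAlgebra I u) →+* Polynomial (Localization.Away u), e₀ =
    Polynomial.eval₂RingHom ((T₀.val.comp (ι : blowupAlgebra I u →ₐ[k] T₀)).toRingHom)
      (Polynomial.C (algebraMap _ (Localization.Away u) u)) := ⟨_, rfl⟩
  have he₀C : ∀ c : blowupAlgebra I u, e₀ (Polynomial.C c) = ((ι c : T₀) : Polynomial (Localization.Away u)) := fun c => by
    rw [he₀, Polynomial.coe_eval₂RingHom, Polynomial.eval₂_C]; rfl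
  have he₀X : e₀ Polynomial.X = Polynomial.C (algebraMap _ (Localization.Away u) u) := by
    rw [he₀, Polynomial.coe_eval₂RingHom, Polynomial.eval₂_X]
  have he₀mem : ∀ Q : Polynomial (blowupAlgebra I u), e₀ Q ∈ A' := fun Q => by
    refine Polynomial.induction_on Q (fun t => ?_) (fun P Q hP hQ => ?_) (fun m t _ => ?_)
    · rw [he₀C]; exact hT₀A' (ι t).2
    · rw [map_add]; exact A'.add_mem hP hQ
    · rw [map_mul, map_pow, he₀C, he₀X]
      exact A'.mul_mem (hT₀A' (ι t).2) (A'.pow_mem hCu _)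
  obtain ⟨e, heval⟩ : ∃ e : Polynomial (blowupAlgebra I u) →+* A', ∀ Q : Polynomial (blowupAlgebra I u),
      ((e Q : A') : Polynomial (Localization.Away u)) = e₀ Q := ⟨e₀.codRestrict A' he₀mem, fun Q => rfl⟩
  refine ⟨e, fun t => by rw [heval, he₀C], by rw [heval, he₀X], ?_⟩
  letI : Algebra (Polynomial (blowupAlgebra I u)) A' := e.toAlgebra
  have halg : ∀ Q, algebraMap (Polynomial (blowupAlgebra I u)) A' Q = e Q := fun Q => by rw [RingHom.algebraMap_toAlgebra]
  -- `u/1` is a unit of `A'`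
  have hunitA : IsUnit (e Polynomial.X) := by
    refine IsUnit.of_mul_eq_one (a := e Polynomial.X) ⟨_, hCinv⟩ (Subtype.ext ?_)
    rw [Subalgebra.coe_mul, heval, he₀X, Subalgebra.coe_one, ← map_mul, IsLocalization.Away.mul_invSelf, map_one]
  refine ⟨?_, ?_, ?_⟩
  · -- units
    rintro ⟨_, t, rfl⟩
    rw [halg, map_pow]
    exact hunitA.pow t
  · -- surjectivity up to powers of `Y`: every element of `A'` is good
    intro z
    have hz : ∃ (Q : Polynomial (blowupAlgebra I u)) (j : ℕ), (z : Polynomial (Localization.Away u)) *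
        Polynomial.C (algebraMap _ (Localization.Away u) u) ^ j = e₀ Q := by
      have hzA := (hA' z).mp z.2
      have hsum := (z : Polynomial (Localization.Away u)).as_sum_support_C_mul_X_pow
      suffices h : ∃ (Q : Polynomial (blowupAlgebra I u)) (j : ℕ), (∑ i ∈ (z : Polynomial (Localization.Away u)).support,
          Polynomial.C ((z : Polynomial (Localization.Away u)).coeff i) * Polynomial.X ^ i) *
          Polynomial.C (algebraMap _ (Localization.Away u) u) ^ j = e₀ Q by
        rwa [← hsum] at h
      refine good_sum f u I e₀ _ he₀X _ _ fun i _ => ?_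
      rw [← classPart_of_mem w f u ha₀ hu lam hlam N (i : ZMod N) (hzA i), map_sum, Finset.sum_mul]
      refine good_sum f u I e₀ _ he₀X _ _ fun m hm => ?_
      rw [Finset.mem_filter] at hm
      exact good_hom w f u ha₀ hu lam hlam T₀ hT₀ I ι e₀ he₀C he₀X _ m i (coaction_coeff w f u ha₀ hu lam hlam _ m) hm.2
    obtain ⟨Q, j, hQ⟩ := hz
    refine ⟨(Q, ⟨Polynomial.X ^ j, j, rfl⟩), Subtype.ext ?_⟩
    show ((z * e (Polynomial.X ^ j) : A') : Polynomial (Localization.Away u)) = ((e Q : A') : Polynomial (Localization.Away u))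
    rw [Subalgebra.coe_mul, heval, heval, map_pow, he₀X]
    exact hQ
  · -- injectivity of `e`
    intro Q Q' hQQ'
    refine ⟨1, ?_⟩
    rw [OneMemClass.coe_one, one_mul, one_mul]
    rw [halg, halg] at hQQ'
    have h0 : e₀ Q = e₀ Q' := by
      rw [← heval, ← heval, hQQ']
    have h1 := map_sub e₀ Q Q'
    rw [h0, sub_self] at h1
    exact sub_eq_zero.mp (eval_u_injective f u lam T₀ hT₀ I ι hN e₀ he₀ hU _ h1)

end

end Summit.ResolutionOfSingularities.ResolutionOfSingularities.Theorems.FInjectiveMacaulayfication.VeroneseLocalization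

end
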